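import Summits.PneNP.PneNP.Theses.ORIncompressibility
import Summits.PneNP.PneNP.Theorems.ORIncompressibilityAssembly
import Summits.PneNP.PneNP.Theorems.ORIncompressibilityOneBitCompressorOfNPSubsetP
import Summits.PneNP.PneNP.Theorems.NPNotSubsetPPoly
import Literature.Computability.Complexity.ClayProblem
import Literature.Computability.Complexity.ClayProblemProofs
import Literature.Computability.Complexity.ClayProblemConsequences
import Literature.Computability.Complexity.InstanceCompression
import Literature.Computability.Complexity.InstanceCompressionProofs
import Literature.Computability.Complexity.AdviceBasics
import Literature.Computability.Complexity.NPClosureProofs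
import Literature.Computability.Complexity.NondeterministicProofs
import Literature.Computability.Complexity.ProbabilisticClasses
import Literature.Computability.Complexity.ProbabilisticClassesProofs
import Literature.Computability.Complexity.CircuitClassesUniformProofs

/-!
# Strategy census — crux `NoORCompression` (stmt-PneNP-0985): kernel-checked obstructions

Unit `cstrat-stmt-PneNP-0985-r1` (crux-strategist, route re-audit bin RESTATED), route
`route-PneNP-ORIncompressibility`. Companion of `STRATEGY-CENSUS.md` (the prose audit of the
decomposition shapes D1–D10) and `Probes.lean` (the BC2(c) cheap probes). Everything here is
sorry-free; nothing here is a route item.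

`X := Summit.PneNP.PneNP.Theses.ORIncompressibility.NoORCompression` (SAT has no polynomial-time
OR-compression: `∀ a ∃ c ∀ f ∈ FP ∃ᶠ n`, on tuples of `n^c` blocks of length `n`, `|f| > n^a` or an
OR-SAT-impure fibre), `S := PneNP`.

* §O0 `pneNP_of_noORCompression : X → S` — one line over the route's `closes` and the two LANDED
  items `Assembly` (stmt-0992) and `OneBitCompressorOfNPSubsetP` (stmt-0991): X is at least the summit
  BY NAME (why the audit bins it RESTATED); `pneNP_iff_not_NP_subset_P`.
* §O1 slicing over the output budget `a`: `SliceAt a`, `noORCompression_iff_forall_sliceAt` (`Iff.rfl`),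
  `pneNP_of_sliceAt_one` (the slice `a = 1` is ALREADY ≥ S — it is all the landed assembly uses),
  `sliceAt_anti` (slices get stronger with `a`), `noORCompression_of_tail` (every cofinal tail IS X).
* §O2 the pure-logic laws over §O0: `piece_ge_summit_of_coPiece` (a piece implied by `¬S` forces its
  partner to be ≥ S), `partner_ge_X_of_notX_consequence`, `pair_ge_summit_of_coPiece`, and the bridge
  seam `bridge_seam : T → (¬X → ¬T) → X` (ONE line), `bridge_iff : (¬X → ¬T) ↔ X ∨ ¬T`,
  `bridge_iff_X_of_T` (given T, the bridge piece IS X), `bridge_hyp_ge_summit`.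
* §O3 every hypothesis KNOWN to imply X is ≥ S in at most fifteen lines over landed inclusions:
  `pneNP_of_NP_ne_coNP` (`NP ≠ coNP`, the route's crux #3 partner), `pneNP_of_not_coNP_subset_polyAdvice_NP`
  (`coNP ⊄ NP/poly`, Fortnow–Santhanam's hypothesis), `pneNP_of_not_NP_subset_coAM` (`NP ⊄ coAM`,
  Drucker's §9 hypothesis), `pneNP_of_not_NP_subset_coNP`, `pneNP_of_npNotSubsetPPoly` (`NP ⊄ P/poly`,
  where the magnification split D8 lands). Root cause, also kernel-checked: `¬S ⇒ ¬X` is the ideal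
  one-bit compressor, so every consequence of `¬X` is a consequence of `¬S`; the consequences in print
  (FS11 Thm 1.2, Drucker TR12-112 Thm 1.2 / Thm 9.16, Harnik–Naor, BDFH09) are PH-internal poly-scale
  collapses that `NP ⊆ P` gives directly.
* §O4 the typed decompositions and their seams: D1 `T_FS ∧ B_FS` (FS bridge), D2 `T_D ∧ B_D` (Drucker
  bridge), D3 `NP ≠ coNP ∧ CompressionCollapse` (the route's own crux #3), D4 the three-piece
  uniformisation chain (`B_D ∧ DerandomisedArthur ∧ NP ⊄ coNP`), each with its hypothesis piece proved
  ≥ S by §O3.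
* §O5 the ideal-compressor law for compressor-CLASS pieces: `RestrictedPiece 𝒦` (X asked only of
  compressors satisfying `𝒦`), `restrictedPiece_of_noORCompression` (each is a consequence of X) and
  `pneNP_of_restrictedPiece`: if every one-bit OR-SAT compressor in `FP` satisfies `𝒦`, the piece is
  already ≥ S. Classes that exclude the ideal compressor (depth-`d` `TC⁰`, formulas, `SIZE(N^{1+1/q})`)
  are typed in §O6–§O7; their partner is a `bridge_seam` with no mechanism (census D6–D8).
* §O6 D7 typed: `W_TC0` (the dropped rung in corrected `∃ᶠ` form = a non-uniform `TC⁰` compression lower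
  bound), `B_TC0 := ¬X → ¬W_TC0`, `seam_D7`, `B_TC0_iff`.
* §O7 D8 typed (hardness magnification): `CheapORCompressible q c` (near-linear-size `B₂` sketches with
  `≤ N^{1/q}` outputs and pure fibres), `X_A` (≥ `NP ⊄ P/poly` in truth, by the ideal compressor), `X_B`
  (no mechanism: the naive self-improvement re-inflates), `seam_D8`;
  D9 typed: `NonuniformNoORCompression` (X for circuit families).
* §O8 Transfer sibling typed: `NoANDCompression` (Drucker's AND-compression statement, same regime).

References: [FortnowSanthanam2011, Thm 1.2 (= Thm 3.1)]; Drucker, *New limits to classical and quantum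
instance compression*, ECCC TR12-112 rev. 3 (= SIAM J. Comput. 44 (2015)), Thm 1.1 p. 9, Thm 1.2–1.3
p. 10, Thm 9.2 p. 68, Thm 9.16 p. 90 (held: paper:galaxy-pdf-8325696699834702300);
[DellVanmelkebeek2014, Lemma 4]; [CookClay2006, §1]; [AroraBarak2009, Def. 2.19, Def. 6.16, §6.4, Def. 7.3, Def. 8.10].
-/

set_option linter.dupNamespace false
set_option autoImplicit false

namespace Summit.PneNP.PneNP.Cruxes.NoORCompression.StrategyCensus

open Filter
open Literature.Computability.Complexity
open Summit.PneNP.PneNP.Theses.ORIncompressibility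

/-! ## §O0 The crux by name; X ≥ S -/

/-- **X ≥ S by name.** `Assembly` (stmt-PneNP-0992) and `OneBitCompressorOfNPSubsetP` (stmt-PneNP-0991)
are proved in the tree, so the route's `closes` makes the crux imply the summit in one line; every
conjunction of pieces proving X proves S. [cite: FortnowSanthanam2011, §1] [folklore] -/
theorem pneNP_of_noORCompression (hX : NoORCompression) : _root_.PneNP :=
  closes Summit.PneNP.PneNP.Theorems.orIncompressibility_assembly_proof
    Summit.PneNP.PneNP.Theorems.orIncompressibility_oneBitCompressorOfNPSubsetP_proof hX

/-- The summit in the prelude's classes: `PneNP ↔ NP ⊄ P` (model bridges `P_bool_eq_holds`,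
`NP_bool_eq_holds`, both proved in the tree). [cite: CookClay2006, §1] [folklore] -/
theorem pneNP_iff_not_NP_subset_P : _root_.PneNP ↔ ¬ (Nondeterministic.NP ⊆ Classes.P) := by
  have hP : PNPWave0.P Bool = Classes.P := P_bool_eq_holds
  have hNP : PNPWave0.NP Bool = Nondeterministic.NP := NP_bool_eq_holds
  show Literature.PNP.PNeNP ↔ _
  unfold Literature.PNP.PNeNP
  rw [hP, hNP, Set.not_subset]

/-- The one-bit OR-SAT compressor exists as soon as `NP ⊆ P` (the landed support item 0991, unfolded).
[cite: FortnowSanthanam2011, §1] [folklore] -/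
theorem exists_oneBit_of_NP_subset_P (h : Nondeterministic.NP ⊆ Classes.P) :
    ∃ f ∈ FP, ∀ xs : List (List Bool), ∃ b : Bool,
      f (xs.foldr boolPair []) = [b] ∧ (b = true ↔ ∃ x ∈ xs, x ∈ SAT) := by
  have h1 := Summit.PneNP.PneNP.Theorems.orIncompressibility_oneBitCompressorOfNPSubsetP_proof
  unfold OneBitCompressorOfNPSubsetP at h1
  exact h1 h

/-! ## §O1 Slicing over the output budget `a` -/

/-- The slice of X at output budget `a`: SOME block exponent `c` defeats every `f ∈ FP` infinitely often
at budget `n^a`. `X = ∀ a, SliceAt a` literally. [cite: FortnowSanthanam2011, Thm 1.2] -/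
def SliceAt (a : ℕ) : Prop :=
  ∃ c : ℕ, ∀ f ∈ FP, ∃ᶠ n : ℕ in atTop, ∃ xs ys : List (List Bool),
    (xs.length = n ^ c ∧ ∀ x ∈ xs, x.length = n) ∧ (ys.length = n ^ c ∧ ∀ y ∈ ys, y.length = n) ∧
    (n ^ a < (f (xs.foldr boolPair [])).length ∨
      (f (xs.foldr boolPair []) = f (ys.foldr boolPair []) ∧
        ¬ ((∃ x ∈ xs, x ∈ SAT) ↔ ∃ y ∈ ys, y ∈ SAT)))

/-- X is literally the conjunction of its slices. [folklore] -/
theorem noORCompression_iff_forall_sliceAt : NoORCompression ↔ ∀ a : ℕ, SliceAt a := Iff.rfl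

/-- **The slice `a = 1` is already ≥ S** — it is everything the landed assembly uses: a one-bit
compressor (from `NP ⊆ P`) has output length `1 ≤ n` and pure fibres. So in `X ⇐ SliceAt 1 ∧ (tail)`
the first piece gives S on its own. [cite: FortnowSanthanam2011, §1] [folklore] -/
theorem pneNP_of_sliceAt_one (h1 : SliceAt 1) : _root_.PneNP := by
  by_contra hcon
  have hsub : Nondeterministic.NP ⊆ Classes.P := by
    by_contra h
    exact hcon (pneNP_iff_not_NP_subset_P.2 h)
  obtain ⟨f, hf, hspec⟩ := exists_oneBit_of_NP_subset_P hsub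
  obtain ⟨c, hc⟩ := h1
  obtain ⟨n, ⟨xs, ys, -, -, hor⟩, hn⟩ := ((hc f hf).and_eventually (eventually_ge_atTop 1)).exists
  obtain ⟨b, hb, hbiff⟩ := hspec xs
  obtain ⟨b', hb', hbiff'⟩ := hspec ys
  rcases hor with hlen | ⟨heq, hne⟩
  · rw [hb, List.length_singleton, pow_one] at hlen
    omega
  · apply hne
    rw [hb, hb'] at heq
    have hbb : b = b' := by simpa using heq
    rw [← hbiff, ← hbiff', hbb]

/-- Slices get STRONGER with the budget: failing the budget `n^b` fails every `n^a`, `a ≤ b` (for `n ≥ 1`,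
which `∃ᶠ` absorbs). [folklore] -/
theorem sliceAt_anti {a b : ℕ} (hab : a ≤ b) (h : SliceAt b) : SliceAt a := by
  obtain ⟨c, hc⟩ := h
  refine ⟨c, fun f hf => ?_⟩
  refine ((hc f hf).and_eventually (eventually_ge_atTop 1)).mono ?_
  rintro n ⟨⟨xs, ys, hxs, hys, hor⟩, hn⟩
  refine ⟨xs, ys, hxs, hys, ?_⟩
  rcases hor with hlen | hrest
  · exact Or.inl (lt_of_le_of_lt (Nat.pow_le_pow_right hn hab) hlen)
  · exact Or.inr hrest

/-- … hence EVERY cofinal tail `∀ a ≥ a₀, SliceAt a` is X itself: the split `X ⇐ (slices < a₀) ∧ (tail)`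
has a piece that gives X on its own. [folklore] -/
theorem noORCompression_of_tail (a₀ : ℕ) (h : ∀ a : ℕ, a₀ ≤ a → SliceAt a) : NoORCompression :=
  fun a => sliceAt_anti (Nat.le_max_right a₀ a) (h _ (Nat.le_max_left a₀ a))

/-- The tail is equivalent to X. [folklore] -/
theorem tail_iff (a₀ : ℕ) : (∀ a : ℕ, a₀ ≤ a → SliceAt a) ↔ NoORCompression :=
  ⟨noORCompression_of_tail a₀, fun hX a _ => hX a⟩

/-! ## §O2 The pure-logic laws (over §O0) -/

/-- If the assembly `A → B → X` is proved and `A` is a consequence of `¬S`, then `B` ALONE is ≥ S. [folklore] -/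
theorem piece_ge_summit_of_coPiece {A B : Prop} (hasm : A → B → NoORCompression) (hA : ¬ _root_.PneNP → A)
    (hB : B) : _root_.PneNP :=
  Classical.byContradiction fun hS => hS (pneNP_of_noORCompression (hasm (hA hS) hB))

/-- If `A` is a consequence of `¬X`, its partner `B` is ≥ X: `A` is not load-bearing. [folklore] -/
theorem partner_ge_X_of_notX_consequence {A B : Prop} (hasm : A → B → NoORCompression)
    (hA : ¬ NoORCompression → A) (hB : B) : NoORCompression :=
  Classical.byContradiction fun hX => hX (hasm (hA hX) hB)

/-- Three-piece version: the pair complementary to a `¬S`-consequence is jointly ≥ S. [folklore] -/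
theorem pair_ge_summit_of_coPiece {A B C : Prop} (hasm : A → B → C → NoORCompression) (hA : ¬ _root_.PneNP → A)
    (hB : B) (hC : C) : _root_.PneNP :=
  Classical.byContradiction fun hS => hS (pneNP_of_noORCompression (hasm (hA hS) hB hC))

/-- **The bridge seam** of every split `T ∧ (T → X)` written as `T ∧ (¬X → ¬T)` ("an OR-compressor would
refute T") is ONE line. [folklore] -/
theorem bridge_seam {T : Prop} (hT : T) (hB : ¬ NoORCompression → ¬ T) : NoORCompression :=
  Classical.byContradiction fun hX => hB hX hT

/-- The bridge piece is `X ∨ ¬T` in disguise. [folklore] -/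
theorem bridge_iff (T : Prop) : (¬ NoORCompression → ¬ T) ↔ (NoORCompression ∨ ¬ T) := by
  tauto

/-- … so GIVEN the hypothesis piece `T`, the bridge piece IS the crux (costume unless `T` is open or the
bridge is a theorem proved by other means). [folklore] -/
theorem bridge_iff_X_of_T {T : Prop} (hT : T) : (¬ NoORCompression → ¬ T) ↔ NoORCompression := by
  tauto

/-- A hypothesis piece refuted by `NP ⊆ P` is ≥ S on its own — the form in which clause (c) fails for every
bridge split of this census. [folklore] -/
theorem bridge_hyp_ge_summit {T : Prop} (hTS : Nondeterministic.NP ⊆ Classes.P → ¬ T) (hT : T) : _root_.PneNP :=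
  pneNP_iff_not_NP_subset_P.2 fun hsub => hTS hsub hT

/-! ## §O3 Every hypothesis known to imply X is ≥ S in a few lines -/

/-- `NP ⊆ P ⇒ NP = coNP` (`P` is closed under complement — landed `compl_mem_P_iff` — and `P ⊆ NP`,
landed `P_subset_NP_holds`). [cite: AroraBarak2009, Def. 2.19] [folklore] -/
theorem NP_eq_coNP_of_NP_subset_P (h : Nondeterministic.NP ⊆ Classes.P) : Nondeterministic.NP = coNP := by
  ext L
  simp only [coNP, co, Set.mem_setOf_eq]
  constructor
  · intro hL
    exact P_subset_NP_holds (compl_mem_P_iff.2 (h hL))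
  · intro hL
    exact P_subset_NP_holds (compl_mem_P_iff.1 (h hL))

/-- **`NP ≠ coNP` is ≥ S** (three lines). This is the hypothesis piece of D3 (the route's own crux #3
`CompressionCollapse` as the bridge). [cite: AroraBarak2009, Def. 2.19] [folklore] -/
theorem pneNP_of_NP_ne_coNP (h : Nondeterministic.NP ≠ coNP) : _root_.PneNP :=
  pneNP_iff_not_NP_subset_P.2 fun hsub => h (NP_eq_coNP_of_NP_subset_P hsub)

/-- `NP ⊄ coNP` is ≥ S as well (hypothesis piece of the uniformisation chain D4). [folklore] -/
theorem pneNP_of_not_NP_subset_coNP (h : ¬ (Nondeterministic.NP ⊆ coNP)) : _root_.PneNP :=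
  pneNP_of_NP_ne_coNP fun he => h (fun L hL => by rw [← he]; exact hL)

/-- `NP ⊆ P ⇒ coNP ⊆ NP/poly` (empty advice; landed `NP_subset_polyAdvice_NP`,
`NP_closed_boolUnpair_fst_holds`). [cite: AroraBarak2009, Def. 6.16] [folklore] -/
theorem coNP_subset_polyAdvice_NP_of_NP_subset_P (h : Nondeterministic.NP ⊆ Classes.P) :
    coNP ⊆ polyAdvice Nondeterministic.NP := by
  intro L hL
  have hc : Lᶜ ∈ Nondeterministic.NP := hL
  have hLP : L ∈ Classes.P := compl_mem_P_iff.1 (h hc)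
  exact NP_subset_polyAdvice_NP NP_closed_boolUnpair_fst_holds (P_subset_NP_holds hLP)

/-- **`coNP ⊄ NP/poly` is ≥ S** — the hypothesis of Fortnow–Santhanam's Thm 1.2, the hypothesis piece of
D1. [cite: FortnowSanthanam2011, Thm 1.2] [folklore] -/
theorem pneNP_of_not_coNP_subset_polyAdvice_NP (h : ¬ (coNP ⊆ polyAdvice Nondeterministic.NP)) :
    _root_.PneNP :=
  pneNP_iff_not_NP_subset_P.2 fun hsub => h (coNP_subset_polyAdvice_NP_of_NP_subset_P hsub)

/-- `NP ⊆ P ⇒ NP ⊆ coAM` (`coAM = co (BP·NP)`; landed `P_subset_BPP_holds`, `bp_mono`, `P_subset_NP_holds`).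
[cite: AroraBarak2009, Def. 8.10] [folklore] -/
theorem NP_subset_coAM_of_NP_subset_P (h : Nondeterministic.NP ⊆ Classes.P) :
    Nondeterministic.NP ⊆ co AM := by
  intro L hL
  simp only [co, AM, Set.mem_setOf_eq]
  have hLc : Lᶜ ∈ Classes.P := compl_mem_P_iff.2 (h hL)
  have hBPP : Lᶜ ∈ BPP := P_subset_BPP_holds hLc
  exact bp_mono P_subset_NP_holds hBPP

/-- **`NP ⊄ coAM` is ≥ S** — the hypothesis of Drucker's Thm 9.16 (uniform collapse from OR-compression),
the hypothesis piece of D2. [cite: AroraBarak2009, Def. 8.10] [folklore] -/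
theorem pneNP_of_not_NP_subset_coAM (h : ¬ (Nondeterministic.NP ⊆ co AM)) : _root_.PneNP :=
  pneNP_iff_not_NP_subset_P.2 fun hsub => h (NP_subset_coAM_of_NP_subset_P hsub)

/-- **`NP ⊄ P/poly` is ≥ S** (landed `P_subset_PPoly_holds`) — where the magnification split D8 lands its
"weak" piece. [cite: AroraBarak2009, §6.4] [folklore] -/
theorem pneNP_of_npNotSubsetPPoly (h : Summit.PneNP.PneNP.NPNotSubsetPPoly) : _root_.PneNP :=
  pneNP_iff_not_NP_subset_P.2 fun hsub => h fun _ hL => P_subset_PPoly_holds (hsub hL)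

/-! ## §O4 The typed bridge decompositions D1–D4 and their seams -/

/-- D1 hypothesis piece: `coNP ⊄ NP/poly`. [cite: FortnowSanthanam2011, Thm 1.2] -/
def T_FS : Prop := ¬ (coNP ⊆ polyAdvice Nondeterministic.NP)

/-- D1 bridge piece: an OR-compressor in X's exact-shape regime puts `coNP ⊆ NP/poly` — Fortnow–Santhanam
Thm 1.2 RE-RUN in the regime "exactly `n^c` blocks of length exactly `n`, cofinitely many `n`, pure fibres"
(the landed `orSAT_compressible_imp_coNP_subset_polyAdvice_NP_holds` is stated for `IsORCompression`,
all tuple lengths with `1ⁿ` appended, so it does not instantiate; its covering lemma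
`FortnowSanthanam.cover` is regime-free). Provable; not a route item. [cite: FortnowSanthanam2011, Thm 1.2 (= Thm 3.1, proof)] -/
def B_FS : Prop := ¬ NoORCompression → coNP ⊆ polyAdvice Nondeterministic.NP

/-- D1 seam (one line) … [folklore] -/
theorem seam_D1 (hT : T_FS) (hB : B_FS) : NoORCompression :=
  Classical.byContradiction fun hX => hT (hB hX)

/-- … and D1's hypothesis piece is ≥ S on its own: clause (c) fails. [cite: FortnowSanthanam2011, Thm 1.2] -/
theorem T_FS_ge_summit (hT : T_FS) : _root_.PneNP := pneNP_of_not_coNP_subset_polyAdvice_NP hT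

/-- What the LANDED Fortnow–Santhanam theorem gives verbatim: the all-lengths compressibility hypothesis
refutes `T_FS`. (So `T_FS` implies FS-incompressibility in the printed regime by name — but not X, whose
negation lives in the exact-shape regime.) [cite: FortnowSanthanam2011, Thm 1.2] -/
theorem not_isORCompression_of_T_FS (hT : T_FS) :
    ¬ ∃ f ∈ FP, ∃ (A : Set (List Bool)) (p : Polynomial ℕ), IsORCompression SAT f A fun n => p.eval n :=
  fun h => hT (orSAT_compressible_imp_coNP_subset_polyAdvice_NP_holds h)

/-- D2 hypothesis piece: `NP ⊄ coAM`. [cite: AroraBarak2009, Def. 8.10] -/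
def T_D : Prop := ¬ (Nondeterministic.NP ⊆ co AM)

/-- D2 bridge piece: Drucker, TR12-112 Thm 9.16 (an OR-compression of `n^{1000c}` SAT instances of length
`n` into `n^c` bits, any target, error ≤ .1 ⇒ `NP ⊆ coAM`, uniformly) read in X's regime (¬X supplies every
block exponent, in particular `1000a`). A cite-grade fact, not vendored in the tree. [cite: AroraBarak2009, Def. 8.10] -/
def B_D : Prop := ¬ NoORCompression → Nondeterministic.NP ⊆ co AM

/-- D2 seam (one line). [folklore] -/
theorem seam_D2 (hT : T_D) (hB : B_D) : NoORCompression :=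
  Classical.byContradiction fun hX => hT (hB hX)

/-- … and D2's hypothesis piece is ≥ S on its own: clause (c) fails. [folklore] -/
theorem T_D_ge_summit (hT : T_D) : _root_.PneNP := pneNP_of_not_NP_subset_coAM hT

/-- D3 = the route's own crux #3 as the bridge: `NP ≠ coNP ∧ CompressionCollapse ⊢ X` in one line …
[cite: FortnowSanthanam2011, §7 (open problems)] [folklore] -/
theorem seam_D3 (hT : Nondeterministic.NP ≠ coNP) (hB : CompressionCollapse) : NoORCompression := by
  unfold CompressionCollapse at hB
  exact Classical.byContradiction fun hX => hT (hB hX)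

/-- … whose hypothesis piece `NP ≠ coNP` is ≥ S (`pneNP_of_NP_ne_coNP`): given it, the summit follows
WITHOUT `CompressionCollapse`, which is therefore not load-bearing for S. [folklore] -/
theorem D3_hyp_ge_summit (hT : Nondeterministic.NP ≠ coNP) : _root_.PneNP := pneNP_of_NP_ne_coNP hT

/-- D4 middle piece ("derandomise Drucker's Arthur"): under an OR-compressor, the coAM protocol for SAT
becomes an NP-proof of unsatisfiability. Open (FS's question sharpened); typed here only to show the
chain's last piece is still ≥ S. [cite: FortnowSanthanam2011, §7 (open problems)] -/
def DerandomisedArthur : Prop :=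
  ¬ NoORCompression → Nondeterministic.NP ⊆ co AM → Nondeterministic.NP ⊆ coNP

/-- D4 seam: `B_D ∧ DerandomisedArthur ∧ (NP ⊄ coNP) ⊢ X`, two lines … [folklore] -/
theorem seam_D4 (hB : B_D) (hD : DerandomisedArthur) (hT : ¬ (Nondeterministic.NP ⊆ coNP)) :
    NoORCompression :=
  Classical.byContradiction fun hX => hT (hD hX (hB hX))

/-- … and the hypothesis piece `NP ⊄ coNP` is ≥ S (`pneNP_of_not_NP_subset_coNP`): however finely the
implication side is sliced, the separation at the end of the chain carries S alone. [folklore] -/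
theorem D4_hyp_ge_summit (hT : ¬ (Nondeterministic.NP ⊆ coNP)) : _root_.PneNP := pneNP_of_not_NP_subset_coNP hT

/-! ## §O5 Compressor-class pieces: the ideal-compressor law -/

/-- `IsOneBitORCompressor f`: `f` sends every tuple code to the single bit `[∃ i, xᵢ ∈ SAT]` — the IDEAL
OR-compressor, in `FP` as soon as `NP ⊆ P` (`exists_oneBit_of_NP_subset_P`). [cite: FortnowSanthanam2011, §1] -/
def IsOneBitORCompressor (f : List Bool → List Bool) : Prop :=
  ∀ xs : List (List Bool), ∃ b : Bool, f (xs.foldr boolPair []) = [b] ∧ (b = true ↔ ∃ x ∈ xs, x ∈ SAT)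

/-- The piece "X asked only of compressors satisfying `𝒦`" (a compressor CLASS: a time bound, a circuit
class computing `f`, a structural property of `f`, …). [folklore] -/
def RestrictedPiece (𝒦 : (List Bool → List Bool) → Prop) : Prop :=
  ∀ a : ℕ, ∃ c : ℕ, ∀ f ∈ FP, 𝒦 f → ∃ᶠ n : ℕ in atTop, ∃ xs ys : List (List Bool),
    (xs.length = n ^ c ∧ ∀ x ∈ xs, x.length = n) ∧ (ys.length = n ^ c ∧ ∀ y ∈ ys, y.length = n) ∧
    (n ^ a < (f (xs.foldr boolPair [])).length ∨
      (f (xs.foldr boolPair []) = f (ys.foldr boolPair []) ∧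
        ¬ ((∃ x ∈ xs, x ∈ SAT) ↔ ∃ y ∈ ys, y ∈ SAT)))

/-- Every class piece is a CONSEQUENCE of X (weaker or equal). [folklore] -/
theorem restrictedPiece_of_noORCompression (𝒦 : (List Bool → List Bool) → Prop) (hX : NoORCompression) :
    RestrictedPiece 𝒦 := fun a => by
  obtain ⟨c, hc⟩ := hX a
  exact ⟨c, fun f hf _ => hc f hf⟩

/-- **The ideal-compressor law.** If the class `𝒦` contains every one-bit OR-SAT compressor of `FP`, the
class piece is ALREADY ≥ S (same three-line contradiction as the landed assembly). So a class piece can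
be (c)-clean only if `𝒦` excludes the ideal compressor — i.e. only for complexity reasons BELOW `P`
(depth, formula size, fixed polynomial size, space), and then its partner must turn an arbitrary
polynomial-time compressor into a `𝒦`-compressor (census D6–D8: no mechanism). [cite: FortnowSanthanam2011, §1] [folklore] -/
theorem pneNP_of_restrictedPiece {𝒦 : (List Bool → List Bool) → Prop}
    (h𝒦 : ∀ f ∈ FP, IsOneBitORCompressor f → 𝒦 f) (h : RestrictedPiece 𝒦) : _root_.PneNP := by
  by_contra hcon
  have hsub : Nondeterministic.NP ⊆ Classes.P := by
    by_contra h'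
    exact hcon (pneNP_iff_not_NP_subset_P.2 h')
  obtain ⟨f, hf, hspec⟩ := exists_oneBit_of_NP_subset_P hsub
  obtain ⟨c, hc⟩ := h 1
  have hK : 𝒦 f := h𝒦 f hf hspec
  obtain ⟨n, ⟨xs, ys, -, -, hor⟩, hn⟩ :=
    ((hc f hf hK).and_eventually (eventually_ge_atTop 1)).exists
  obtain ⟨b, hb, hbiff⟩ := hspec xs
  obtain ⟨b', hb', hbiff'⟩ := hspec ys
  rcases hor with hlen | ⟨heq, hne⟩
  · rw [hb, List.length_singleton, pow_one] at hlen
    omega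
  · apply hne
    rw [hb, hb'] at heq
    have hbb : b = b' := by simpa using heq
    rw [← hbiff, ← hbiff', hbb]

/-- The partner of a class piece is a bridge piece: `¬X → ¬RestrictedPiece 𝒦` ("an `FP` compressor yields a
`𝒦`-compressor"), and it is `X ∨ ¬RestrictedPiece 𝒦` in disguise. [folklore] -/
theorem classPartner_iff (𝒦 : (List Bool → List Bool) → Prop) :
    (¬ NoORCompression → ¬ RestrictedPiece 𝒦) ↔ (NoORCompression ∨ ¬ RestrictedPiece 𝒦) :=
  bridge_iff _

/-! ## §O6 D7 typed: a `TC⁰` compression lower bound + "compressors can be made shallow" -/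

/-- `W_TC0` — the dropped rung `NoTC0CompressionSAT` (stmt-PneNP-0988, refuted AS STATED on the `∀ n ≥ n₀`
form) in corrected `∃ᶠ` form: for infinitely many block lengths `n`, no family of `m ≤ n^{c'}` depth-`d`
size-`(n^c·n)^k` `TC⁰` circuits on `n^c` SAT blocks has OR-SAT-pure fibres (`c' < c`). A non-uniform
`TC⁰` lower bound for an NP function in compression clothing (at `m = 1` it contains "OR-SAT ∉ TC⁰_d");
consistent with `NP ⊆ P` (clause (c) clean), behind the natural-proofs wall (no plan). [cite: FortnowSanthanam2011, Thm 1.2] -/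
def W_TC0 : Prop :=
  ∀ d k c c' : ℕ, c' < c → ∃ᶠ n : ℕ in atTop, ∀ m ≤ n ^ c', ∀ C : Fin m → Circuit (Fin (n ^ c * n)),
    (∀ j, (C j).IsOver tcBasis ∧ (C j).acDepth ≤ d ∧ (C j).size ≤ (n ^ c * n) ^ k) →
    ∃ x y : Fin (n ^ c * n) → Bool, (∀ j, (C j).eval x = (C j).eval y) ∧
      ¬ ((∃ i : Fin (n ^ c), List.ofFn (fun l : Fin n => x (finProdFinEquiv (i, l))) ∈ SAT) ↔
        ∃ i : Fin (n ^ c), List.ofFn (fun l : Fin n => y (finProdFinEquiv (i, l))) ∈ SAT)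

/-- `B_TC0` — the partner: a polynomial-time OR-compressor for SAT could be made constant-depth `TC⁰`
(non-uniformly, with polynomially related parameters). No mechanism is known or conjectured: the only
depth reduction for P-computations guesses a tableau, and a compressor has no room for it. [folklore] -/
def B_TC0 : Prop := ¬ NoORCompression → ¬ W_TC0

/-- D7 seam = `bridge_seam` (one line). [folklore] -/
theorem seam_D7 (hW : W_TC0) (hB : B_TC0) : NoORCompression := bridge_seam hW hB

/-- … and the partner is `X ∨ ¬W_TC0`: given the lower bound it IS X. [folklore] -/
theorem B_TC0_iff : B_TC0 ↔ (NoORCompression ∨ ¬ W_TC0) := bridge_iff _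

/-! ## §O7 D8 typed: hardness magnification / compression self-improvement; D9: the non-uniform X -/

/-- `CheapORCompressible q c`: for all large `n`, writing `N := n^c · n` for the total input length, some
family of `m` general (`B₂`) circuits with `m^q ≤ N` (at most `N^{1/q}` output bits) and total size `s` with
`s^q ≤ N^{q+1}` (size at most `N^{1+1/q}`) has OR-SAT-pure fibres on tuples of `n^c` blocks of length `n`.
[cite: FortnowSanthanam2011, Thm 1.2] -/
def CheapORCompressible (q c : ℕ) : Prop :=
  ∀ᶠ n : ℕ in atTop, ∃ m : ℕ, m ^ q ≤ n ^ c * n ∧ ∃ C : Fin m → Circuit (Fin (n ^ c * n)),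
    (∀ j, (C j).IsOver B2) ∧ (∑ j, (C j).size) ^ q ≤ (n ^ c * n) ^ (q + 1) ∧
    ∀ x y : Fin (n ^ c * n) → Bool, (∀ j, (C j).eval x = (C j).eval y) →
      ((∃ i : Fin (n ^ c), List.ofFn (fun l : Fin n => x (finProdFinEquiv (i, l))) ∈ SAT) ↔
        ∃ i : Fin (n ^ c), List.ofFn (fun l : Fin n => y (finProdFinEquiv (i, l))) ∈ SAT)

/-- `X_B` (the magnification-side bridge: "an `FP` OR-compressor yields NEAR-LINEAR-SIZE compressors for all
large block exponents"). Status: implied by X (vacuously) and by `NP ⊆ P/poly` (the ideal compressor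
`OR ∘ (SAT-circuit per block)` has size `n^c · n^k + n^c ≤ N^{1+1/q}` once `c + 1 ≥ q (k - 1) + 1`); in the
remaining world (¬X, `NP ⊄ P/poly`) NO mechanism is known. In particular the naive self-improvement
"group the blocks, compress each group by `f`, re-encode the outputs as SAT instances (Cook–Levin on the
image language, landed) and repeat" does NOT work: the image language's NP-witness is the whole group, so
the re-encoded SAT instance is at least as long as the group it summarises — lengths multiply by `≥ c₁ + 1`
per level and the data never shrinks (census D8). [cite: FortnowSanthanam2011, Thm 1.2] -/
def X_B : Prop :=
  ¬ NoORCompression → ∀ q : ℕ, 0 < q → ∃ c₀ : ℕ, ∀ c : ℕ, c₀ ≤ c → CheapORCompressible q c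

/-- `X_A` (the magnified "barely superlinear" lower bound): for some `q`, for arbitrarily large block
exponents `c`, OR-compressing SAT tuples into `N^{1/q}` bits needs size `> N^{1+1/q}` infinitely often.
NOT consistent-looking with `NP ⊆ P/poly`: the ideal compressor has size `n^c · n^k + n^c ≤ N^{1+1/q}` as
soon as `c + 1 ≥ q (k - 1) + 1`, so `X_A ⇒ SAT ∉ SIZE(n^k)` for every `k`, i.e. `X_A ⇒ NPNotSubsetPPoly ⇒ S`
(`pneNP_of_npNotSubsetPPoly`) by the trivial compressor — clause (c) fails in truth: the block surplus
makes the ideal compressor near-linear, so the "weak" piece is secretly `NP ⊄ P/poly`. The same holds for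
the uniform near-linear-TIME variant (ideal compressor in time `N · n^{k-1}`), which is ≥ S directly.
[cite: CookClay2006, §3] -/
def X_A : Prop :=
  ∃ q : ℕ, 0 < q ∧ ∀ c₀ : ℕ, ∃ c : ℕ, c₀ ≤ c ∧ ¬ CheapORCompressible q c

/-- D8 seam (five lines of logic). [folklore] -/
theorem seam_D8 (hA : X_A) (hB : X_B) : NoORCompression := by
  by_contra hX
  obtain ⟨q, hq, hA'⟩ := hA
  obtain ⟨c₀, hc₀⟩ := hB hX q hq
  obtain ⟨c, hc, hnc⟩ := hA' c₀
  exact hnc (hc₀ c hc)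

/-- D9: the NON-UNIFORM strengthening `X_nu` (no polynomial-size circuit family OR-compresses SAT tuples,
`∃ᶠ` form). It implies X in truth (`FP` functions have polynomial-size multi-output circuits, Arora–Barak
Thm 6.6, plus list/bit-vector transcoding — routine, not landed for string functions), so as a PIECE it
gives X on its own; as a STRENGTHENING it is known exactly under the same hypothesis `coNP ⊄ NP/poly`
(FS counting is oblivious to uniformity). [cite: FortnowSanthanam2011, Thm 1.2] -/
def NonuniformNoORCompression : Prop :=
  ∀ a : ℕ, ∃ c : ℕ, ∀ k : ℕ, ∃ᶠ n : ℕ in atTop, ∀ m ≤ n ^ a, ∀ C : Fin m → Circuit (Fin (n ^ c * n)),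
    (∀ j, (C j).IsOver B2 ∧ (C j).size ≤ (n ^ c * n) ^ k) →
    ∃ x y : Fin (n ^ c * n) → Bool, (∀ j, (C j).eval x = (C j).eval y) ∧
      ¬ ((∃ i : Fin (n ^ c), List.ofFn (fun l : Fin n => x (finProdFinEquiv (i, l))) ∈ SAT) ↔
        ∃ i : Fin (n ^ c), List.ofFn (fun l : Fin n => y (finProdFinEquiv (i, l))) ∈ SAT)

/-! ## §O8 Transfer sibling typed: AND-compression (Drucker) -/

/-- `NoANDCompression`: the AND-sibling of X (same regime, `∀` in place of `∃` in the block predicate).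
Its status is identical: known exactly under `NP ⊄ coNP/poly` (Drucker TR12-112 Thm 1.1, AND-compression
of any NP-complete `L` ⇒ `L ∈ coNP/poly`) or `NP ⊄ coAM` (Thm 9.16), both ≥ S by §O3; no unconditional
sibling exists to transfer FROM. [cite: FortnowSanthanam2011, §7 (open problems)] -/
def NoANDCompression : Prop :=
  ∀ a : ℕ, ∃ c : ℕ, ∀ f ∈ FP, ∃ᶠ n : ℕ in atTop, ∃ xs ys : List (List Bool),
    (xs.length = n ^ c ∧ ∀ x ∈ xs, x.length = n) ∧ (ys.length = n ^ c ∧ ∀ y ∈ ys, y.length = n) ∧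
    (n ^ a < (f (xs.foldr boolPair [])).length ∨
      (f (xs.foldr boolPair []) = f (ys.foldr boolPair []) ∧
        ¬ ((∀ x ∈ xs, x ∈ SAT) ↔ ∀ y ∈ ys, y ∈ SAT)))

end Summit.PneNP.PneNP.Cruxes.NoORCompression.StrategyCensus
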